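import Summits.Ventures.CertifiedArithmetic.LowPrec.ExactNecessaryProducts
import Summits.Ventures.CertifiedArithmetic.LowPrec.ExactWideFP6FP4

/-!
# THEOREMS-R1 Theorem S (sharp form) is a criterion for non-degenerate operand formats

HONEST FRAMING (venture CertifiedArithmetic / cell `pub-lowprec`): certified error envelopes and
provably optimal rounding/accumulation schemes for low-precision formats under stated cost models;
every table by two implementations; no hardware or vendor claims.

`exactSums_of_spanSides` (ExactCriteria.lean) proves that (i) `qexp_R ≤ min(qexp_X, qexp_Y)`,
(ii′) the two span inequalities and (iii) `maxRat_X + maxRat_Y ≤ maxRat_R` imply `ExactSums X Y R`,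
and `ExactNecessary.lean` that (i) and (iii) are necessary while (ii′) is not necessary for
degenerate operand formats. This def-free file closes the gap: for operand formats of precision
`≥ 2` that contain their all-ones significand (`2^P − 1 ≤ maxScaled` — every named format does),
EACH SPAN INEQUALITY IS NECESSARY (`spanSide_of_exactSums`), so that Theorem S in its sharp form is
a CRITERION decided by the format parameters alone:

  `exactSums_iff : ExactSums X Y R ↔ (i) ∧ Span(X, Y, R) ∧ Span(Y, X, R) ∧ (iii)`.

Proof of the necessity of `Span(X, Y, R)`, i.e. of `T·2^a + M_Y·2^b < 2^(P_R + a)` with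
`T = 2^P_X − 1`, `a = (qexp_X − qexp_Y)⁺`, `b = (qexp_Y − qexp_X)⁺`, `M_Y = D·2^i` (`D` odd), by an
explicit inexact sum in each case (magnitudes in units of the operands' own quanta; the sum is
`c · 2^v` common quanta with `c` odd and `c ≥ 2^P_R`, refuted by `not_exactSums_of_witness`):
* `a = b = 0`, `M_Y` even: `T + M_Y`;  `M_Y` odd (then `M_Y = 2^P_Y − 1`): `(T − 1) + M_Y =
  2^P_X + 2^P_Y − 3 ≥ 2^P_R` because `2^P_X + 2^P_Y − 2` is not a power of two (`P_X, P_Y ≥ 2`);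
* `a = 0 < b`: `T + M_Y 2^b`;
* `b = 0 < a`: `i > a`: `T·2^a + M_Y = (T + D 2^(i−a))·2^a`; `i < a`: `= (T 2^(a−i) + D)·2^i`;
  `i = a`: `T·2^a + M_Y/2 = (2T + D)·2^(a−1)`.
The case table was found and checked by brute force over 52 637 failing small-format cases before
it was proved here for all formats.
-/

namespace Summit.Ventures.CertifiedArithmetic

open Literature.ComputerArithmetic.FloatingPoint
open Literature.ComputerArithmetic.FloatingPoint.MiniFloat
open Literature.ComputerArithmetic.FloatingPoint.Format

/-- The value of `ofScaled _ false n` at a representable magnitude is `n · 2^qexp`. [folklore] -/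
theorem toRat_ofScaled_false {φ : Format} {n : ℕ} (hle : n ≤ φ.maxScaled)
    (hr : φ.Representable n) : (ofScaled φ false n hle).toRat = (n : ℚ) * 2 ^ φ.qexp := by
  rw [toRat_ofScaled hle hr]
  simp [Format.quantum]

/-- A representable ODD magnitude is a bare significand: `n < 2^P`. [folklore] -/
theorem lt_pow_of_representable_odd {φ : Format} {n : ℕ} (hr : φ.Representable n) (ho : Odd n) :
    n < 2 ^ (φ.manBits + 1) := by
  obtain ⟨-, k, j, hk, hn⟩ := representable_iff.mp hr
  rcases Nat.eq_zero_or_pos j with hj | hj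
  · subst hj
    have hnk : n = k := by simpa using hn
    rw [hnk]; exact hk
  · exfalso
    obtain ⟨j', rfl⟩ : ∃ j', j = j' + 1 := ⟨j - 1, by omega⟩
    have he : Even n := ⟨k * 2 ^ j', by rw [hn, pow_succ]; ring⟩
    exact (Nat.not_even_iff_odd.mpr ho) he

/-- Half of a representable magnitude is representable. [folklore] -/
theorem representable_div_two {φ : Format} {n : ℕ} (hr : φ.Representable n) :
    φ.Representable (n / 2) := by
  obtain ⟨hle, k, j, hk, hn⟩ := representable_iff.mp hr
  have hle' : n / 2 ≤ φ.maxScaled := (Nat.div_le_self n 2).trans hle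
  rcases Nat.eq_zero_or_pos j with hj | hj
  · subst hj
    have hnk : n = k := by simpa using hn
    exact representable_of_lt_pow (lt_of_le_of_lt (hnk ▸ Nat.div_le_self n 2) hk) hle'
  · obtain ⟨j', rfl⟩ : ∃ j', j = j' + 1 := ⟨j - 1, by omega⟩
    have hn2 : n / 2 = k * 2 ^ j' := by
      rw [hn, pow_succ, ← mul_assoc, Nat.mul_div_cancel _ two_pos]
    have hle'' : k * 2 ^ j' ≤ φ.maxScaled := hn2 ▸ hle'
    rw [hn2]
    exact representable_mul_pow hk hle''

/-- `2^P₁ + 2^P₂ − 2` is not a power of two when `P₁, P₂ ≥ 2` (it lies strictly between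
`2^max` and `2^(max+1)`). [folklore] -/
theorem two_pow_ne_add_sub_two {P₁ P₂ R : ℕ} (h₁ : 2 ≤ P₁) (h₂ : 2 ≤ P₂) :
    2 ^ R ≠ 2 ^ P₁ + 2 ^ P₂ - 2 := by
  intro h
  have h4₁ : 4 ≤ 2 ^ P₁ := le_trans (by norm_num) (Nat.pow_le_pow_right two_pos h₁)
  have h4₂ : 4 ≤ 2 ^ P₂ := le_trans (by norm_num) (Nat.pow_le_pow_right two_pos h₂)
  rcases le_total P₁ P₂ with hP | hP
  · have hle : 2 ^ P₁ ≤ 2 ^ P₂ := Nat.pow_le_pow_right two_pos hP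
    have hgt : ¬ R ≤ P₂ := fun hR => by
      have := Nat.pow_le_pow_right two_pos hR; omega
    have hlt : ¬ P₂ + 1 ≤ R := fun hR => by
      have := Nat.pow_le_pow_right two_pos hR; rw [pow_succ] at this; omega
    omega
  · have hle : 2 ^ P₂ ≤ 2 ^ P₁ := Nat.pow_le_pow_right two_pos hP
    have hgt : ¬ R ≤ P₁ := fun hR => by
      have := Nat.pow_le_pow_right two_pos hR; omega
    have hlt : ¬ P₁ + 1 ≤ R := fun hR => by
      have := Nat.pow_le_pow_right two_pos hR; rw [pow_succ] at this; omega
    omega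

/-- Generic parameter-level witness: magnitudes `n₁ ∈ F₁`, `n₂ ∈ F₂` (in their own quanta) whose
aligned sum `n₁ 2^a + n₂ 2^b` equals `c · 2^v` with `c` odd and `c ≥ 2^P_R` refute `ExactSums`
(`qexp₁ = L + a`, `qexp₂ = L + b`). -/
theorem not_exactSums_of_scaled_witness {φ₁ φ₂ ψ : Format} {L : ℤ} {a b : ℕ}
    (ha : φ₁.qexp = L + a) (hb : φ₂.qexp = L + b) {n₁ n₂ : ℕ} (hle₁ : n₁ ≤ φ₁.maxScaled)
    (hr₁ : φ₁.Representable n₁) (hle₂ : n₂ ≤ φ₂.maxScaled) (hr₂ : φ₂.Representable n₂)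
    {c v : ℕ} (hc : Odd c) (hsum : n₁ * 2 ^ a + n₂ * 2 ^ b = c * 2 ^ v)
    (hge : 2 ^ (ψ.manBits + 1) ≤ c) : ¬ ExactSums φ₁ φ₂ ψ := by
  refine not_exactSums_of_witness (ofScaled φ₁ false n₁ hle₁) (ofScaled φ₂ false n₂ hle₂) c
    (L + v) hc ?_ (Or.inr hge)
  have h2 : (2 : ℚ) ≠ 0 := two_ne_zero
  have hq : ((n₁ * 2 ^ a + n₂ * 2 ^ b : ℕ) : ℚ) = ((c * 2 ^ v : ℕ) : ℚ) := by rw [hsum]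
  push_cast at hq
  rw [toRat_ofScaled_false hle₁ hr₁, toRat_ofScaled_false hle₂ hr₂, ha, hb, zpow_add₀ h2,
    zpow_add₀ h2, zpow_add₀ h2, zpow_natCast, zpow_natCast, zpow_natCast]
  calc (n₁ : ℚ) * (2 ^ L * 2 ^ a) + (n₂ : ℚ) * (2 ^ L * 2 ^ b)
      = ((n₁ : ℚ) * 2 ^ a + (n₂ : ℚ) * 2 ^ b) * 2 ^ L := by ring
    _ = ((c : ℚ) * 2 ^ v) * 2 ^ L := by rw [hq]
    _ = (c : ℚ) * (2 ^ L * 2 ^ v) := by ring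

/-- NECESSITY OF THE SPAN INEQUALITY `Span(φ₁, φ₂, ψ)` (the hypothesis `hS₁` of
`exactSums_of_spanSides`) for operand formats of precision `≥ 2` containing their all-ones
significand: if every sum is a value of `ψ` then
`min(M₁, 2^P₁ − 1)·2^a + M₂·2^b < 2^(P_R + a)`. The mirror inequality follows by
`ExactSums.symm` (ExactWideFP6FP4.lean). -/
theorem spanSide_of_exactSums {φ₁ φ₂ ψ : Format} (hm₁ : 1 ≤ φ₁.manBits) (hm₂ : 1 ≤ φ₂.manBits)
    (h₁ : 2 ^ (φ₁.manBits + 1) - 1 ≤ φ₁.maxScaled) (h₂ : 2 ^ (φ₂.manBits + 1) - 1 ≤ φ₂.maxScaled)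
    (h : ExactSums φ₁ φ₂ ψ) :
    min φ₁.maxScaled (2 ^ (φ₁.manBits + 1) - 1) * 2 ^ (φ₁.qexp - φ₂.qexp).toNat
        + φ₂.maxScaled * 2 ^ (φ₂.qexp - φ₁.qexp).toNat
      < 2 ^ (ψ.manBits + 1 + (φ₁.qexp - φ₂.qexp).toNat) := by
  rw [min_eq_right h₁]
  have hkey : φ₁.qexp + ((φ₂.qexp - φ₁.qexp).toNat : ℤ) = φ₂.qexp + ((φ₁.qexp - φ₂.qexp).toNat : ℤ)
      ∧ ((φ₁.qexp - φ₂.qexp).toNat = 0 ∨ (φ₂.qexp - φ₁.qexp).toNat = 0) := by omega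
  generalize (φ₁.qexp - φ₂.qexp).toNat = a at hkey ⊢
  generalize (φ₂.qexp - φ₁.qexp).toNat = b at hkey ⊢
  obtain ⟨hab, hab0⟩ := hkey
  have ha : φ₁.qexp = (φ₁.qexp - a) + a := by omega
  have hb : φ₂.qexp = (φ₁.qexp - a) + b := by omega
  -- the all-ones significands
  set T := 2 ^ (φ₁.manBits + 1) - 1 with hT
  have hp₁ : 4 ≤ 2 ^ (φ₁.manBits + 1) :=
    le_trans (by norm_num) (Nat.pow_le_pow_right two_pos (by omega : 2 ≤ φ₁.manBits + 1))
  have hp₂ : 4 ≤ 2 ^ (φ₂.manBits + 1) :=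
    le_trans (by norm_num) (Nat.pow_le_pow_right two_pos (by omega : 2 ≤ φ₂.manBits + 1))
  have hTodd : Odd T :=
    Nat.Even.sub_odd Nat.one_le_two_pow (Nat.even_pow.mpr ⟨even_two, by omega⟩) odd_one
  have hrT : φ₁.Representable T := representable_of_lt_pow (by omega) h₁
  have hrT' : φ₁.Representable (T - 1) := representable_of_lt_pow (by omega) (by omega)
  have hrM : φ₂.Representable φ₂.maxScaled := representable_maxScaled φ₂
  have hM0 : φ₂.maxScaled ≠ 0 := by omega
  have hPR : 0 < 2 ^ (ψ.manBits + 1) := by positivity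
  by_contra hside
  rw [not_lt, pow_add] at hside
  rcases hab0 with ha0 | hb0
  · -- a = 0 : φ₁ is the finer (or equal) format
    subst ha0
    simp only [pow_zero, mul_one] at hside
    rcases Nat.eq_zero_or_pos b with hb0 | hbpos
    · -- a = b = 0
      subst hb0
      simp only [pow_zero, mul_one] at hside
      rcases Nat.even_or_odd φ₂.maxScaled with hev | hodd
      · -- witness T + M₂
        exact not_exactSums_of_scaled_witness ha hb h₁ hrT le_rfl hrM (c := T + φ₂.maxScaled)
          (v := 0) (hTodd.add_even hev) (by simp) hside h
      · -- M₂ odd, hence M₂ = 2^P₂ - 1; witness (T - 1) + M₂ = 2^P₁ + 2^P₂ - 3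
        have hM : φ₂.maxScaled < 2 ^ (φ₂.manBits + 1) := lt_pow_of_representable_odd hrM hodd
        have hne := two_pow_ne_add_sub_two (R := ψ.manBits + 1) (by omega : 2 ≤ φ₁.manBits + 1)
          (by omega : 2 ≤ φ₂.manBits + 1)
        exact not_exactSums_of_scaled_witness ha hb (by omega) hrT' le_rfl hrM
          (c := T - 1 + φ₂.maxScaled) (v := 0) ((Nat.Odd.sub_odd hTodd odd_one).add_odd hodd)
          (by simp) (by omega) h
    · -- a = 0 < b : witness T + M₂ 2^b
      have hev : Even (φ₂.maxScaled * 2 ^ b) :=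
        (Nat.even_pow.mpr ⟨even_two, hbpos.ne'⟩).mul_left _
      exact not_exactSums_of_scaled_witness ha hb h₁ hrT le_rfl hrM
        (c := T + φ₂.maxScaled * 2 ^ b) (v := 0) (hTodd.add_even hev) (by simp) hside h
  · -- b = 0 < a (the case a = 0 is covered above, so assume 0 < a) : φ₁ is the coarser format
    subst hb0
    simp only [pow_zero, mul_one] at hside
    rcases Nat.eq_zero_or_pos a with ha0 | hapos
    · subst ha0
      simp only [pow_zero, mul_one] at hside
      rcases Nat.even_or_odd φ₂.maxScaled with hev | hodd
      · exact not_exactSums_of_scaled_witness ha hb h₁ hrT le_rfl hrM (c := T + φ₂.maxScaled)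
          (v := 0) (hTodd.add_even hev) (by simp) hside h
      · have hM : φ₂.maxScaled < 2 ^ (φ₂.manBits + 1) := lt_pow_of_representable_odd hrM hodd
        have hne := two_pow_ne_add_sub_two (R := ψ.manBits + 1) (by omega : 2 ≤ φ₁.manBits + 1)
          (by omega : 2 ≤ φ₂.manBits + 1)
        exact not_exactSums_of_scaled_witness ha hb (by omega) hrT' le_rfl hrM
          (c := T - 1 + φ₂.maxScaled) (v := 0) ((Nat.Odd.sub_odd hTodd odd_one).add_odd hodd)
          (by simp) (by omega) h
    · -- 0 < a: split on the 2-adic valuation i of M₂ = 2^i · D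
      obtain ⟨i, D, hD, hMD⟩ := Nat.exists_eq_two_pow_mul_odd hM0
      rcases lt_trichotomy i a with hia | hia | hia
      · -- i < a : T 2^a + M₂ = (T 2^(a-i) + D) 2^i
        obtain ⟨d, hd⟩ := Nat.exists_eq_add_of_lt hia
        have hsum : T * 2 ^ a + φ₂.maxScaled * 2 ^ 0 = (T * 2 ^ (d + 1) + D) * 2 ^ i := by
          rw [hMD, hd, pow_zero, mul_one]; ring
        have hc : Odd (T * 2 ^ (d + 1) + D) :=
          Even.add_odd ((Nat.even_pow.mpr ⟨even_two, by omega⟩).mul_left _) hD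
        refine not_exactSums_of_scaled_witness ha hb h₁ hrT le_rfl hrM hc hsum ?_ h
        refine Nat.le_of_mul_le_mul_right ?_ (by positivity : 0 < 2 ^ i)
        calc 2 ^ (ψ.manBits + 1) * 2 ^ i ≤ 2 ^ (ψ.manBits + 1) * 2 ^ a :=
              Nat.mul_le_mul_left _ (Nat.pow_le_pow_right two_pos hia.le)
          _ ≤ T * 2 ^ a + φ₂.maxScaled := hside
          _ = (T * 2 ^ (d + 1) + D) * 2 ^ i := by rw [← hsum, pow_zero, mul_one]
      · -- i = a : T 2^a + M₂ / 2 = (2T + D) 2^(a-1)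
        rw [hia] at hMD
        obtain ⟨e, he⟩ := Nat.exists_eq_add_of_lt hapos
        rw [zero_add] at he
        have hhalf : φ₂.maxScaled / 2 = 2 ^ e * D := by
          rw [hMD, he, pow_succ, mul_assoc, mul_comm 2 D, ← mul_assoc, Nat.mul_div_cancel _ two_pos]
        have hle₂ : 2 ^ e * D ≤ φ₂.maxScaled := hhalf ▸ Nat.div_le_self _ 2
        have hr₂ : φ₂.Representable (2 ^ e * D) := hhalf ▸ representable_div_two hrM
        have hsum : T * 2 ^ a + 2 ^ e * D * 2 ^ 0 = (2 * T + D) * 2 ^ e := by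
          rw [he, pow_zero, mul_one]; ring
        have hc : Odd (2 * T + D) := (even_two_mul T).add_odd hD
        refine not_exactSums_of_scaled_witness ha hb h₁ hrT hle₂ hr₂ hc hsum ?_ h
        have hTD : 2 ^ (ψ.manBits + 1) * 2 ^ a ≤ (T + D) * 2 ^ a := by
          calc 2 ^ (ψ.manBits + 1) * 2 ^ a ≤ T * 2 ^ a + φ₂.maxScaled := hside
            _ = (T + D) * 2 ^ a := by rw [hMD]; ring
        have := Nat.le_of_mul_le_mul_right hTD (by positivity : 0 < 2 ^ a)
        omega
      · -- a < i : T 2^a + M₂ = (T + D 2^(i-a)) 2^a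
        obtain ⟨d, hd⟩ := Nat.exists_eq_add_of_lt hia
        have hsum : T * 2 ^ a + φ₂.maxScaled * 2 ^ 0 = (T + 2 ^ (d + 1) * D) * 2 ^ a := by
          rw [hMD, hd, pow_zero, mul_one]; ring
        have hc : Odd (T + 2 ^ (d + 1) * D) :=
          hTodd.add_even ((Nat.even_pow.mpr ⟨even_two, by omega⟩).mul_right _)
        refine not_exactSums_of_scaled_witness ha hb h₁ hrT le_rfl hrM hc hsum ?_ h
        refine Nat.le_of_mul_le_mul_right ?_ (by positivity : 0 < 2 ^ a)
        calc 2 ^ (ψ.manBits + 1) * 2 ^ a ≤ T * 2 ^ a + φ₂.maxScaled := hside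
          _ = (T + 2 ^ (d + 1) * D) * 2 ^ a := by rw [← hsum, pow_zero, mul_one]

/-- THEOREM S IS A CRITERION (every destination; operand formats of precision `≥ 2` containing their
all-ones significand — every named format does): every sum of values of `φ₁` and `φ₂` is a value of
`ψ` iff (i) `qexp_R ≤ min(qexp₁, qexp₂)`, (ii′) both span inequalities of Lemma C′, and (iii)
`maxRat₁ + maxRat₂ ≤ maxRat_R` — four conditions decidable in the format parameters. The `←`
direction is `exactSums_of_spanSides` (ExactCriteria.lean). -/
theorem exactSums_iff {φ₁ φ₂ ψ : Format} (hm₁ : 1 ≤ φ₁.manBits) (hm₂ : 1 ≤ φ₂.manBits)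
    (h₁ : 2 ^ (φ₁.manBits + 1) - 1 ≤ φ₁.maxScaled) (h₂ : 2 ^ (φ₂.manBits + 1) - 1 ≤ φ₂.maxScaled) :
    ExactSums φ₁ φ₂ ψ ↔
      ψ.qexp ≤ min φ₁.qexp φ₂.qexp ∧
      min φ₁.maxScaled (2 ^ (φ₁.manBits + 1) - 1) * 2 ^ (φ₁.qexp - φ₂.qexp).toNat
          + φ₂.maxScaled * 2 ^ (φ₂.qexp - φ₁.qexp).toNat
        < 2 ^ (ψ.manBits + 1 + (φ₁.qexp - φ₂.qexp).toNat) ∧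
      min φ₂.maxScaled (2 ^ (φ₂.manBits + 1) - 1) * 2 ^ (φ₂.qexp - φ₁.qexp).toNat
          + φ₁.maxScaled * 2 ^ (φ₁.qexp - φ₂.qexp).toNat
        < 2 ^ (ψ.manBits + 1 + (φ₂.qexp - φ₁.qexp).toNat) ∧
      φ₁.maxRat + φ₂.maxRat ≤ ψ.maxRat := by
  have hS₁ : 1 ≤ φ₁.maxScaled :=
    le_trans (Nat.le_sub_one_of_lt (Nat.one_lt_two_pow (by omega))) h₁
  have hS₂ : 1 ≤ φ₂.maxScaled :=
    le_trans (Nat.le_sub_one_of_lt (Nat.one_lt_two_pow (by omega))) h₂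
  constructor
  · intro h
    obtain ⟨hi, hiii⟩ := exactSums_necessary hS₁ hS₂ h
    exact ⟨hi, spanSide_of_exactSums hm₁ hm₂ h₁ h₂ h, spanSide_of_exactSums hm₂ hm₁ h₂ h₁ h.symm,
      hiii⟩
  · rintro ⟨hi, hs₁, hs₂, hiii⟩
    exact exactSums_of_spanSides φ₁ φ₂ ψ hi hs₁ hs₂ hiii

/-- The criterion decides keys by parameters alone, in both directions: `e3m2 + e3m2 → e3m2` is
inexact because `Span` fails (`7 + 28 ≥ 8`) … -/
example : ¬ ExactSums E3M2 E3M2 E3M2 := fun h =>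
  absurd ((exactSums_iff (by decide) (by decide) (by decide) (by decide)).mp h).2.1 (by decide)

/-- … and `e3m2 + e3m2 → e2m3` because (i) fails (`qexp(e2m3) = -3 > -4 = qexp(e3m2)`). -/
example : ¬ ExactSums E3M2 E3M2 E2M3 := fun h =>
  absurd ((exactSums_iff (by decide) (by decide) (by decide) (by decide)).mp h).1 (by decide)

end Summit.Ventures.CertifiedArithmetic
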